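import Literature.Barriers.CriticalPhenomena.LongRangeTrivialityOnZ3Newman
import Literature.Probability.LatticeModels.AizenmanWickBoundCouplings

/-!
# The deviation from Wick's law for long-range pair interactions from its unit-coupling
# finite-graph form; the barrier `LongRangeTrivialityOnZ3` on the trust base of the
# nearest-neighbour barrier's random-current input

Sibling of `Literature/Barriers/CriticalPhenomena/LongRangeTrivialityOnZ3.lean` (barrier catalogue
D-0021, sub-problem `Ising3DConformalLimit`). After `…Wick`, `…NoSlidingScale` and `…Newman`, the
barrier rests on three named facts (`LongRangeTrivialityOnZ3.of_threeFacts`), the first being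
`aizenman_pairInteraction_wickDeviation_le_finite` — Aizenman's Proposition 12.1 / Panis's
Proposition 4.6 in finite volume for a GENERAL ferromagnetic pair interaction on `ℤ^d`
(`|⟨σ_{x₁}⋯σ_{x₂ₙ}⟩_{Λ,J,0,β} - 𝒢_n| ≤ (3/2) R_{2n}`). The tree also carries the same proposition
for UNIT couplings on an arbitrary finite simple graph, `aizenman_wickDeviation_le_finite`
(`Literature/Probability/LatticeModels/AizenmanWickBound.lean`), the random-current input of the
nearest-neighbour `d ≥ 4` barrier `IsingTrivialityFromDimensionFour`.
`Literature/Probability/LatticeModels/AizenmanWickBoundCouplings.lean` proves that the unit-coupling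
form implies the general-coupling form on any finite set (decoration transformation + continuity
in the couplings). Here this is specialised to `⟨·⟩_{Λ,J,0,β} = LongRangeIsing.expectIn J Λ β 0`
(`= PairIsing.avg ((β/2)J|_Λ)`, `expectIn_zero_eq_avg` of `…Newman`):

* `aizenman_pairInteraction_wickDeviation_le_finite_of_unit :
    aizenman_wickDeviation_le_finite → aizenman_pairInteraction_wickDeviation_le_finite`;
* `LongRangeTrivialityOnZ3.of_unitWick : aizenman_wickDeviation_le_finite → panis_treeDiagramBound →
    panis_infraredBound_algebraic → LongRangeTrivialityOnZ3` — the long-range `ℤ³` barrier and the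
  nearest-neighbour `d ≥ 4` barrier now share their random-current leaf.

## References

* M. Aizenman, Comm. Math. Phys. 86 (1982) 1–48, Prop. 12.1, eq. (12.3), p. 37 ("it suffices to
  prove (12.3) for finite systems of Ising spins, with a general two point ferromagnetic
  interaction") [AizenmanCMP1982] — through `AizenmanWickBound.lean`.
* R. Panis, arXiv:2309.05797 (2023) = Ann. Probab. 54 (2026), Prop. 4.6; Theorem 1.2
  [Panis2023Triviality].

## Tree anchors

`corrIn`, `pairIn`, `ursellFourIn`, `aizenman_pairInteraction_wickDeviation_le_finite`,
`panis_evenMoment_deviation_le_wick_of_finite` (`…Wick`); `expectIn_zero_eq_avg`,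
`LongRangeTrivialityOnZ3.of_threeFacts`, `panis_thm12_dim3_of_threeFacts` (`…Newman`);
`PairIsing.wickDeviation_le`, `PairIsing.ursellFour` (`AizenmanWickBoundCouplings`);
`pairingSum_congr_of_eq` (`GaussianPairingBound`), `wickRemainder_congr_of_eq` (`AizenmanWickBound`).
-/

noncomputable section

namespace Literature.Barriers.CriticalPhenomena

open Literature.Probability.LatticeModels Literature.Probability.Percolation Finset

namespace LongRangeIsing

variable {d : ℕ} (J : Site d → Site d → ℝ) (Λ : Finset (Site d)) (β : ℝ)

/-- Finite-volume correlations of sites of `Λ` are pair-interaction averages of spin monomials on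
`↥Λ` (couplings `(β/2)J_{a,b}`). [cite: Panis2023Triviality, §1.2.1 (⟨F⟩_{Λ,J,h,β})] -/
theorem corrIn_coe_eq_avg {m : ℕ} (y : Fin m → ↥Λ) :
    corrIn J Λ β (fun i => (y i : Site d)) = PairIsing.avg (fun a b : ↥Λ => β / 2 * J a b) (spinMonomial y) := by
  rw [corrIn, expectIn_zero_eq_avg]
  congr 1
  funext τ
  exact Finset.prod_congr rfl fun i _ => spinAt_glue_coe τ .free (y i)

/-- Finite-volume two-point functions of sites of `Λ` are pair-interaction averages of spin pairs on
`↥Λ`. [cite: Panis2023Triviality, §1.2.1 (⟨F⟩_{Λ,J,h,β})] -/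
theorem pairIn_coe_eq_avg (a b : ↥Λ) :
    pairIn J Λ β a b = PairIsing.avg (fun a b : ↥Λ => β / 2 * J a b) (spinPair a b) := by
  rw [pairIn, expectIn_zero_eq_avg]
  congr 1
  funext τ
  rw [spinPair, spinAt_glue_coe τ .free a, spinAt_glue_coe τ .free b]

end LongRangeIsing

open LongRangeIsing

/-- **Aizenman's Proposition 12.1 / Panis's Proposition 4.6 in finite volume for a general
ferromagnetic pair interaction on `ℤ^d`, from the unit-coupling finite-graph statement**:
`aizenman_wickDeviation_le_finite → aizenman_pairInteraction_wickDeviation_le_finite`. The state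
`⟨·⟩_{Λ,J,0,β}` is `PairIsing.avg ((β/2)J|_Λ)`; its correlations, two-point functions and `U₄`'s of
sites of `Λ` are those of that average (`corrIn_coe_eq_avg`, `pairIn_coe_eq_avg`), to which
`PairIsing.wickDeviation_le` applies. [cite: AizenmanCMP1982, Prop. 12.1, eq. (12.3) (p. 37)] [cite: Panis2023Triviality, Prop. 4.6] -/
theorem aizenman_pairInteraction_wickDeviation_le_finite_of_unit (hW : aizenman_wickDeviation_le_finite) :
    aizenman_pairInteraction_wickDeviation_le_finite := by
  intro d J hJ Λ β hβ n hn x hx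
  set c : ↥Λ → ↥Λ → ℝ := fun a b => β / 2 * J a b with hc
  have hc0 : ∀ a b : ↥Λ, a ≠ b → 0 ≤ c a b := fun a b _ => mul_nonneg (div_nonneg hβ zero_le_two) (hJ _ _)
  set x' : Fin (2 * n) → ↥Λ := fun i => ⟨x i, hx i⟩ with hx'
  have hN : corrIn J Λ β x = PairIsing.avg c (spinMonomial x') := corrIn_coe_eq_avg J Λ β x'
  have h2 : ∀ i j, pairIn J Λ β (x i) (x j) = PairIsing.avg c (spinPair (x' i) (x' j)) :=
    fun i j => pairIn_coe_eq_avg J Λ β (x' i) (x' j)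
  have hNe : ∀ e : Fin 4 → Fin (2 * n), corrIn J Λ β (x ∘ e) = PairIsing.avg c (spinMonomial (x' ∘ e)) :=
    fun e => corrIn_coe_eq_avg J Λ β (x' ∘ e)
  have hU : ∀ e : Fin 4 → Fin (2 * n), ursellFourIn J Λ β (x ∘ e) = PairIsing.ursellFour c (x' ∘ e) := by
    intro e
    rw [ursellFourIn, PairIsing.ursellFour_def, hNe e]
    simp only [Function.comp_apply, h2]
  rw [hN, pairingSum_congr_of_eq (pairIn J Λ β) (fun a b => PairIsing.avg c (spinPair a b)) n x x' h2,
    wickRemainder_congr_of_eq (pairIn J Λ β) (fun a b => PairIsing.avg c (spinPair a b)) (ursellFourIn J Λ β)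
      (PairIsing.ursellFour c) n x x' h2 hU]
  exact PairIsing.wickDeviation_le hW c hc0 hn x'

/-- **The corrected moment display of Panis's proof from the unit-coupling Prop. 12.1.**
[cite: Panis2023Triviality, proof of Theorem 5.5, first display (p. 21), from Proposition 4.6] -/
theorem panis_evenMoment_deviation_le_wick_of_unit (hW : aizenman_wickDeviation_le_finite) :
    panis_evenMoment_deviation_le_wick :=
  panis_evenMoment_deviation_le_wick_of_finite (aizenman_pairInteraction_wickDeviation_le_finite_of_unit hW)

/-- **Theorem 1.2 of Panis 2023 at `d = 3` from the unit-coupling Prop. 12.1, the tree diagram bound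
and the infrared bound.** [cite: Panis2023Triviality, Theorem 1.2 (d = 3)] -/
theorem panis_thm12_dim3_of_unitWick (hW : aizenman_wickDeviation_le_finite) (hT : panis_treeDiagramBound)
    (hI : panis_infraredBound_algebraic) : panis_thm12_dim3 :=
  panis_thm12_dim3_of_threeFacts (aizenman_pairInteraction_wickDeviation_le_finite_of_unit hW) hT hI

/-- **The barrier `LongRangeTrivialityOnZ3` from three named facts, the first shared with the
nearest-neighbour barrier**: Aizenman's Prop. 12.1 for unit couplings on finite graphs
(`aizenman_wickDeviation_le_finite`, random currents), the tree diagram bound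
(`panis_treeDiagramBound`) and the infrared bound (`panis_infraredBound_algebraic`).
[cite: Panis2023Triviality, Theorem 1.2 and proof of Theorem 5.5 (pp. 21–22)] -/
theorem LongRangeTrivialityOnZ3.of_unitWick (hW : aizenman_wickDeviation_le_finite)
    (hT : panis_treeDiagramBound) (hI : panis_infraredBound_algebraic) : LongRangeTrivialityOnZ3 :=
  LongRangeTrivialityOnZ3.of_threeFacts (aizenman_pairInteraction_wickDeviation_le_finite_of_unit hW) hT hI

end Literature.Barriers.CriticalPhenomena

end
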